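import Summits.KontsevichZagierPeriods.KontsevichZagierPeriods.Theses.HurwitzMicroSectors
import Summits.KontsevichZagierPeriods.KontsevichZagierPeriods.Theorems.HurwitzMicroSectorsNormalFormPrinciplePiBoxTransfer
import Summits.KontsevichZagierPeriods.KontsevichZagierPeriods.Theorems.HurwitzMicroSectorsNormalFormPrincipleVariants2313

/-! TTRL-lite variant V2315 of stmt-KontsevichZagierPeriods-3869

Variant V2315 = `stub_boxRigidity` (the leaf `BoxRigidity` of `NormalFormPrinciple`: two representations
on open unit boxes with integrands of KZ's rational shape `p/q` over `ℚ` and equal values are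
KZ-equivalent) under the move `bound_nat:m≤6; bound_nat:m'≤6` — BOTH dimensions bounded by `6`
(hypotheses in the generated order `m' ≤ 6 → m ≤ 6`). Verdict of the attempt seat: **open** — this file
is the exact-strength certificate, not a proof of the variant. Writing `BoxVanishing K` for "a
box-rational representation of dimension `K` and value `0` is a relation":

* `stub_boxRigidity_var2315_iff_le_six` — V2315 is the two-sided bounded leaf `BoxRigidity(m, m' ≤ 6)`
  (only the order of the two bounds differs);
* `stub_boxRigidity_var2315_iff_var2313`, `…_iff_boxVanishing_six` — hence the SAME statement as the
  diagonal freeze V2313 (pair `(6, 6)`) and as `BoxVanishing 6` (pad to the `6`-box, subtract there,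
  soundness; conversely compare with the zero representation — the tree's
  `boxRigidityPair_iff_boxVanishingDim` / `boxRigidityPair_iff_boxRigidityLe`);
* `boxVanishing_le_six_of_stub_boxRigidity_var2315` — it yields `BoxVanishing j` for every `j ≤ 6`, in
  particular "`a + b·ζ(5) = 0 ⇒ [a + b/(1 − x₁⋯x₅)]_{(0,1)⁵}` is a relation" (`j = 5`, today reachable only
  through `ζ(5) ∉ ℚ`, open), the `ζ(3) ∈ ℚ + ℚπ²` case split (`j = 3`) and Catalan's dichotomy (`j = 2`);
* `stub_boxRigidity_var2315_of_boxVanishing_six`, `…_of_parent`, `…_of_statement` — it is implied by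
  `BoxVanishing 6` alone, by the parent leaf and by the Summit (`leaves_of_statement`), so a refutation of
  V2315 would refute `KontsevichZagierPeriods` for the tree's calculus, and the tree has no additive
  invariant of `KZ.relations` finer than `KZ.eval`;
* the same statement with `6 ↦ 1` IS a theorem, already in the tree verbatim as
  `stub_boxRigidity_var2229_slice_le_one` (`…Variants2229`, from `boxRigidity_of_le_one`, Baker); the first
  open rung is `2` (Catalan's dichotomy).
Source: M. Kontsevich, D. Zagier, *Periods* (2001), §1.2 Conjecture 1 and rules 1)–3); A. Baker,
*Transcendental Number Theory* (1975), Thm. 2.1 (the rung below). Pure proof file, no definitions. -/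

-- `Summit.<Summit>.<Problem>` is the tree's mandated summit-side namespace (CONVENTIONS §2); for this
-- single-conjunct summit the two coincide, so the duplicate is deliberate.
set_option linter.dupNamespace false

noncomputable section

namespace Summit.KontsevichZagierPeriods.KontsevichZagierPeriods.Theorems

open MeasureTheory Set
open Literature.NumberTheory.Transcendental Literature.NumberTheory.Transcendental.KZ
open Summit.KontsevichZagierPeriods.KontsevichZagierPeriods.Theses.HurwitzMicroSectors
open Summit.KontsevichZagierPeriods.HurwitzMicroSectors.NormalFormPrinciple.PiBox

/-! ## The variant V2315 itself: the bounded leaf, i.e. `BoxVanishing 6` -/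

/-- **V2315 ⟺ `BoxRigidity(m, m' ≤ 6)`**: the generated variant lists the two bounds in the order
`m' ≤ 6 → m ≤ 6`; swapping them gives the two-sided bounded leaf verbatim.
[cite: KontsevichZagier2001, §1.2 Conjecture 1] -/
theorem stub_boxRigidity_var2315_iff_le_six :
    (∀ (m m' : ℕ) (N : IntegralRep m) (N' : IntegralRep m'), m' ≤ 6 → m ≤ 6 → N.domain = {x | ∀ i, x i ∈ Set.Ioo (0:ℝ) 1} → N.IsRational → N'.domain = {x | ∀ i, x i ∈ Set.Ioo (0:ℝ) 1} → N'.IsRational → N.value = N'.value → Equivalent N N') ↔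
    (∀ (m m' : ℕ) (N : IntegralRep m) (N' : IntegralRep m'), m ≤ 6 → m' ≤ 6 →
      N.domain = {x | ∀ i, x i ∈ Set.Ioo (0:ℝ) 1} → N.IsRational →
      N'.domain = {x | ∀ i, x i ∈ Set.Ioo (0:ℝ) 1} → N'.IsRational →
      N.value = N'.value → Equivalent N N') :=
  ⟨fun h m m' N N' hm hm' => h m m' N N' hm' hm, fun h m m' N N' hm' hm => h m m' N N' hm hm'⟩

/-- **V2315 ⟺ the sibling V2313** (the diagonal freeze `fix m := 6; fix m' := 6`): both are the bounded
leaf `BoxRigidity(m, m' ≤ 6)` (`stub_boxRigidity_var2313_iff_le_six`). [cite: KontsevichZagier2001, §1.2 Conjecture 1] -/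
theorem stub_boxRigidity_var2315_iff_var2313 :
    (∀ (m m' : ℕ) (N : IntegralRep m) (N' : IntegralRep m'), m' ≤ 6 → m ≤ 6 → N.domain = {x | ∀ i, x i ∈ Set.Ioo (0:ℝ) 1} → N.IsRational → N'.domain = {x | ∀ i, x i ∈ Set.Ioo (0:ℝ) 1} → N'.IsRational → N.value = N'.value → Equivalent N N') ↔
    (∀ (N : IntegralRep 6) (N' : IntegralRep 6), N.domain = {x | ∀ i, x i ∈ Set.Ioo (0:ℝ) 1} →
      N.IsRational → N'.domain = {x | ∀ i, x i ∈ Set.Ioo (0:ℝ) 1} → N'.IsRational →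
      N.value = N'.value → Equivalent N N') := by
  rw [stub_boxRigidity_var2315_iff_le_six, stub_boxRigidity_var2313_iff_le_six]

/-- **V2315 ⟺ `BoxVanishing 6`** (the honest residual of the variant): a box-rational representation on
the `6`-box of value `0` is a relation — Conjecture 1 for vanishing rational periods of dimension `6`
(among them `π²`, `π⁴`, `π⁶`, `ζ(3)`, `ζ(5)`, `ζ(3)²`, Catalan's `G` and every multiple zeta value of
weight `≤ 6`, smaller boxes being reached by padding). [cite: KontsevichZagier2001, §1.2 Conjecture 1] -/
theorem stub_boxRigidity_var2315_iff_boxVanishing_six :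
    (∀ (m m' : ℕ) (N : IntegralRep m) (N' : IntegralRep m'), m' ≤ 6 → m ≤ 6 → N.domain = {x | ∀ i, x i ∈ Set.Ioo (0:ℝ) 1} → N.IsRational → N'.domain = {x | ∀ i, x i ∈ Set.Ioo (0:ℝ) 1} → N'.IsRational → N.value = N'.value → Equivalent N N') ↔
    (∀ (M : IntegralRep 6), M.domain = {x | ∀ i, x i ∈ Set.Ioo (0:ℝ) 1} →
      M.IsRational → M.value = 0 → of M ∈ relations) := by
  rw [stub_boxRigidity_var2315_iff_var2313, stub_boxRigidity_var2313_iff_boxVanishing_six]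

/-! ## Consequences downward, and the variant from above -/

/-- **V2315 ⇒ `BoxVanishing` in every dimension `j ≤ 6`** (through V2313): in particular the
dimension-`5` statement containing the `ζ(5)` dichotomy and the dimension-`2` one containing Catalan's.
[cite: KontsevichZagier2001, §1.2 Conjecture 1] -/
theorem boxVanishing_le_six_of_stub_boxRigidity_var2315
    (h : ∀ (m m' : ℕ) (N : IntegralRep m) (N' : IntegralRep m'), m' ≤ 6 → m ≤ 6 → N.domain = {x | ∀ i, x i ∈ Set.Ioo (0:ℝ) 1} → N.IsRational → N'.domain = {x | ∀ i, x i ∈ Set.Ioo (0:ℝ) 1} → N'.IsRational → N.value = N'.value → Equivalent N N')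
    {j : ℕ} (hj : j ≤ 6) (N : IntegralRep j) (hNd : N.domain = {x | ∀ i, x i ∈ Set.Ioo (0:ℝ) 1})
    (hNr : N.IsRational) (hv : N.value = 0) : of N ∈ relations :=
  boxVanishing_le_six_of_stub_boxRigidity_var2313 (stub_boxRigidity_var2315_iff_var2313.1 h) hj N hNd hNr hv

/-- **`BoxVanishing 6` alone already proves V2315** (whoever settles Conjecture 1 for vanishing
box-rational periods of dimension `6` settles V2315, and conversely). [cite: KontsevichZagier2001, §1.2 Conjecture 1] -/
theorem stub_boxRigidity_var2315_of_boxVanishing_six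
    (hvan : ∀ (M : IntegralRep 6), M.domain = {x | ∀ i, x i ∈ Set.Ioo (0:ℝ) 1} → M.IsRational →
      M.value = 0 → of M ∈ relations) :
    ∀ (m m' : ℕ) (N : IntegralRep m) (N' : IntegralRep m'), m' ≤ 6 → m ≤ 6 → N.domain = {x | ∀ i, x i ∈ Set.Ioo (0:ℝ) 1} → N.IsRational → N'.domain = {x | ∀ i, x i ∈ Set.Ioo (0:ℝ) 1} → N'.IsRational → N.value = N'.value → Equivalent N N' :=
  stub_boxRigidity_var2315_iff_boxVanishing_six.2 hvan

/-- **The parent leaf ⇒ V2315** (drop the two bounds; the converse is not claimed — the parent is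
`BoxVanishing` in ALL dimensions). [cite: KontsevichZagier2001, §1.2 Conjecture 1] -/
theorem stub_boxRigidity_var2315_of_parent
    (h : ∀ (m m' : ℕ) (N : IntegralRep m) (N' : IntegralRep m'), N.domain = {x | ∀ i, x i ∈ Set.Ioo (0:ℝ) 1} → N.IsRational → N'.domain = {x | ∀ i, x i ∈ Set.Ioo (0:ℝ) 1} → N'.IsRational → N.value = N'.value → Equivalent N N') :
    ∀ (m m' : ℕ) (N : IntegralRep m) (N' : IntegralRep m'), m' ≤ 6 → m ≤ 6 → N.domain = {x | ∀ i, x i ∈ Set.Ioo (0:ℝ) 1} → N.IsRational → N'.domain = {x | ∀ i, x i ∈ Set.Ioo (0:ℝ) 1} → N'.IsRational → N.value = N'.value → Equivalent N N' :=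
  fun m m' N N' _ _ => h m m' N N'

/-- **`KontsevichZagierPeriods ⇒ V2315`**: the variant is a special case of Conjecture 1 for the tree's
calculus (`leaves_of_statement`) — so a refutation of the variant would refute the Summit.
[cite: KontsevichZagier2001, §1.2 Conjecture 1] -/
theorem stub_boxRigidity_var2315_of_statement (h : _root_.KontsevichZagierPeriods) :
    ∀ (m m' : ℕ) (N : IntegralRep m) (N' : IntegralRep m'), m' ≤ 6 → m ≤ 6 → N.domain = {x | ∀ i, x i ∈ Set.Ioo (0:ℝ) 1} → N.IsRational → N'.domain = {x | ∀ i, x i ∈ Set.Ioo (0:ℝ) 1} → N'.IsRational → N.value = N'.value → Equivalent N N' :=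
  stub_boxRigidity_var2315_of_parent (leaves_of_statement h).1

end Summit.KontsevichZagierPeriods.KontsevichZagierPeriods.Theorems

end
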